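import Literature.Geometry.Symplectic.AlmostComplexTangentBundle
import Literature.Geometry.Symplectic.CompatibleAlmostComplexStructureExists
import Literature.AlgebraicTopology.CharacteristicClasses.TopologicalChernClassesProofs
import HarnessLib

/-!
# Chern classes of an almost complex manifold; the first Chern class and canonical class of a
# symplectic manifold

Topic `Literature/Geometry/Symplectic`. McDuff–Salamon, *Introduction to Symplectic Topology*
(3rd ed. 2017): Remark 2.7.2 / Remark 4.1.10 — for an almost complex manifold `(M, J)`,
"`c := c₁(TM, J) ∈ H²(M; ℤ)` the first Chern class" of the complex vector bundle `(TM, J)`;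
Definition 4.1.4 / Prop. 4.1.1 — for a nondegenerate `2`-form `ω` the space `𝒥(M, ω)` of
compatible almost complex structures is nonempty and contractible, so "the first Chern class
`c₁(ω) := c₁(TM, J) ∈ H²(M; ℤ)` is independent of the choice of `J ∈ 𝒥(M, ω)`"; §4.4 (after
Example 4.4.1) — the **canonical class** `K := -c₁(TX, J) = -c₁(ω)` of a symplectic four-manifold
(Gompf–Stipsicz 1999, §10.1).

This file NAMES these classes over the tree's singular cohomology, on top of
`AlmostComplexStructure.complexTangentBundle` (`AlmostComplexTangentBundle.lean`: `(TM, J)` as a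
`ComplexVectorBundle`) and the integral Chern classes `chernClassZ`
(`CharacteristicClasses/TopologicalChernClassesProofs.lean`, Grothendieck's construction, proved):

* `AlmostComplexStructure.chernClass J i : H²ⁱ(M; ℤ)`, `firstChernClass J : H²(M; ℤ)`,
  `canonicalClass J := -c₁(TM, J)`; `c₀ = 1`, `cᵢ = 0` for `i > dim M / 2`;
* `symplecticFirstChernClass s hs hnd : H²(M; ℤ)` — `c₁(TM, J)` for THE compatible almost complex
  structure `J = compatibleAlmostComplexStructureOf s hs hnd` chosen (by `Classical.choose`) from
  the nonempty space `𝒥(M, s)` (`exists_almostComplexStructure_isCompatibleWith`, McDuff–Salamon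
  Prop. 4.1.1 (i), proved in `CompatibleAlmostComplexStructureExists.lean`), and
  `symplecticCanonicalClass := -symplecticFirstChernClass`.

What is NOT here: the independence of `c₁(TM, J)` from `J ∈ 𝒥(M, ω)` (McDuff–Salamon
Prop. 4.1.1 (ii): contractibility of `𝒥(M, ω)`, plus homotopy invariance of Chern classes) — the
symplectic classes below are those of one chosen compatible `J`; no named facts are introduced.

## References

* D. McDuff, D. Salamon, *Introduction to Symplectic Topology*, 3rd ed. (2017), Rem. 2.7.2,
  Prop. 4.1.1, Def. 4.1.4, Rem. 4.1.10, §4.4. [McDuffSalamon2017]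
* R. E. Gompf, A. I. Stipsicz, *4-Manifolds and Kirby Calculus* (1999), §10.1 (canonical class).
  [GompfStipsiczGSM1999]
-/

noncomputable section

open scoped Manifold ContDiff
open Module Literature.AlgebraicTopology.CharacteristicClasses
  Literature.AlgebraicTopology.SingularHomology

namespace Literature.Geometry.Symplectic

/-! ### Chern classes of an almost complex manifold -/

namespace AlmostComplexStructure

variable {E : Type*} [NormedAddCommGroup E] [NormedSpace ℝ E] [FiniteDimensional ℝ E]
  {H : Type*} [TopologicalSpace H] {I : ModelWithCorners ℝ E H}
  {M : Type} [TopologicalSpace M] [ChartedSpace H M] [IsManifold I 1 M] {n : WithTop ℕ∞}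

/-- **The Chern classes `cᵢ(TM, J) ∈ H²ⁱ(M; ℤ)` of an almost complex manifold**: the integral
Chern classes (`chernClassZ`) of the complex vector bundle `(TM, J)` (`complexTangentBundle`).
[cite: McDuffSalamon2017, Remark 2.7.2] -/
def chernClass (J : AlmostComplexStructure I n M) (i : ℕ) : singularCohomology ℤ ℤ M (2 * i) :=
  chernClassZ J.complexTangentBundle i

/-- `c₀(TM, J) = 1`. [folklore] -/
theorem chernClass_zero (J : AlmostComplexStructure I n M) :
    J.chernClass 0 = singularCohomology.one ℤ M :=
  chernClassZ_zero _

/-- `cᵢ(TM, J) = 0` for `i > dim M / 2` (the complex rank of `(TM, J)`). [folklore] -/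
theorem chernClass_eq_zero_of_lt (J : AlmostComplexStructure I n M) {i : ℕ}
    (hi : finrank ℝ E / 2 < i) : J.chernClass i = 0 :=
  chernClassZ_eq_zero_of_rank_lt _ (by rwa [rank_complexTangentBundle])

/-- **The first Chern class `c₁(TM, J) ∈ H²(M; ℤ)` of an almost complex manifold** (McDuff–Salamon
2017, Remark 2.7.2; Remark 4.1.10: "denote by `c := c₁(TM, J) ∈ H²(M; ℤ)` the first Chern
class"). [cite: McDuffSalamon2017, Remark 4.1.10] -/
def firstChernClass (J : AlmostComplexStructure I n M) : singularCohomology ℤ ℤ M 2 :=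
  degCast ℤ (mul_one 2) (J.chernClass 1)

/-- `c₁(TM, J)` is `chernClass J 1` read in degree `2`. [folklore] -/
theorem firstChernClass_eq (J : AlmostComplexStructure I n M) :
    J.firstChernClass = degCast ℤ (mul_one 2) (J.chernClass 1) :=
  rfl

/-- **The canonical class `K := -c₁(TM, J)`** of an almost complex manifold (McDuff–Salamon
2017, §4.4: "`K := -c₁(TX, J)`"; Gompf–Stipsicz 1999, §10.1). [cite: McDuffSalamon2017, §4.4] -/
def canonicalClass (J : AlmostComplexStructure I n M) : singularCohomology ℤ ℤ M 2 :=
  -J.firstChernClass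

/-- `K = -c₁`. [folklore] -/
theorem canonicalClass_eq_neg (J : AlmostComplexStructure I n M) :
    J.canonicalClass = -J.firstChernClass :=
  rfl

/-- `c₁ = -K`. [folklore] -/
theorem firstChernClass_eq_neg_canonicalClass (J : AlmostComplexStructure I n M) :
    J.firstChernClass = -J.canonicalClass :=
  (neg_neg _).symm

end AlmostComplexStructure

/-! ### The first Chern class and the canonical class of a symplectic manifold -/

section Symplectic

variable {E : Type*} [NormedAddCommGroup E] [InnerProductSpace ℝ E] [FiniteDimensional ℝ E]
  {H : Type*} [TopologicalSpace H] {I : ModelWithCorners ℝ E H}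
  {M : Type} [TopologicalSpace M] [ChartedSpace H M] [IsManifold I ∞ M] [T2Space M]
  [SigmaCompactSpace M]

/-- **A compatible almost complex structure of a nondegenerate `2`-form**, chosen once and for all
from the nonempty space `𝒥(M, s)` (McDuff–Salamon 2017, Prop. 4.1.1 (i), the tree's
`exists_almostComplexStructure_isCompatibleWith`). [cite: McDuffSalamon2017, Prop. 4.1.1 (i)] -/
def compatibleAlmostComplexStructureOf (s : Kaehler.MForm I M ℝ 2) (hs : Kaehler.IsSmoothForm s)
    (hnd : ∀ (x : M) (v : TangentSpace I x), v ≠ 0 → ∃ w : TangentSpace I x, s x ![v, w] ≠ 0) :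
    AlmostComplexStructure I ∞ M :=
  Classical.choose (exists_almostComplexStructure_isCompatibleWith s hs hnd)

/-- The chosen almost complex structure is `s`-compatible. [cite: McDuffSalamon2017, Prop. 4.1.1 (i)] -/
theorem isCompatibleWith_compatibleAlmostComplexStructureOf (s : Kaehler.MForm I M ℝ 2)
    (hs : Kaehler.IsSmoothForm s)
    (hnd : ∀ (x : M) (v : TangentSpace I x), v ≠ 0 → ∃ w : TangentSpace I x, s x ![v, w] ≠ 0) :
    (compatibleAlmostComplexStructureOf s hs hnd).IsCompatibleWith s :=
  Classical.choose_spec (exists_almostComplexStructure_isCompatibleWith s hs hnd)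

/-- **The first Chern class `c₁(s) ∈ H²(M; ℤ)` of a nondegenerate smooth `2`-form** (McDuff–Salamon
2017, Def. 4.1.4: `c₁(ω) := c₁(TM, J)` for `J ∈ 𝒥(M, ω)`), here for the chosen compatible `J`
(`compatibleAlmostComplexStructureOf`); its independence of `J` (Prop. 4.1.1 (ii)) is not proved in
this file. [cite: McDuffSalamon2017, Definition 4.1.4] -/
def symplecticFirstChernClass (s : Kaehler.MForm I M ℝ 2) (hs : Kaehler.IsSmoothForm s)
    (hnd : ∀ (x : M) (v : TangentSpace I x), v ≠ 0 → ∃ w : TangentSpace I x, s x ![v, w] ≠ 0) :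
    singularCohomology ℤ ℤ M 2 :=
  (compatibleAlmostComplexStructureOf s hs hnd).firstChernClass

/-- **The canonical class `K = -c₁(s)` of a symplectic manifold** (McDuff–Salamon 2017, §4.4;
Gompf–Stipsicz 1999, §10.1), for the chosen compatible `J`. [cite: McDuffSalamon2017, §4.4] -/
def symplecticCanonicalClass (s : Kaehler.MForm I M ℝ 2) (hs : Kaehler.IsSmoothForm s)
    (hnd : ∀ (x : M) (v : TangentSpace I x), v ≠ 0 → ∃ w : TangentSpace I x, s x ![v, w] ≠ 0) :
    singularCohomology ℤ ℤ M 2 :=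
  (compatibleAlmostComplexStructureOf s hs hnd).canonicalClass

/-- `K(s) = -c₁(s)`. [folklore] -/
theorem symplecticCanonicalClass_eq_neg (s : Kaehler.MForm I M ℝ 2) (hs : Kaehler.IsSmoothForm s)
    (hnd : ∀ (x : M) (v : TangentSpace I x), v ≠ 0 → ∃ w : TangentSpace I x, s x ![v, w] ≠ 0) :
    symplecticCanonicalClass s hs hnd = -symplecticFirstChernClass s hs hnd :=
  rfl

end Symplectic

end Literature.Geometry.Symplectic

end
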